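import Mathlib
import HarnessLib
import Literature.Analysis.FluidPDE.ClassicalSolution
import Literature.Analysis.FluidPDE.VectorCalculus
import Literature.Analysis.FluidPDE.VectorCalculusProofs
import Literature.Analysis.FluidPDE.TaoLocalisation
import Literature.Analysis.FluidPDE.TaoLocalisationHolds
import Literature.Analysis.FluidPDE.TaoLocalisationProofs
import Literature.Analysis.FluidPDE.TaoEnstrophyLocalisation
import Literature.Analysis.FluidPDE.TaoEnstrophyLocalisationProofs
import Literature.Analysis.FluidPDE.NSVorticityBKMContinuation
import Literature.Analysis.FluidPDE.BKMClassGradientContinuity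
import Literature.Analysis.FluidPDE.Wei2016Slice
import Literature.Analysis.FluidPDE.NearBeltramiEnstrophyCriterion
import Literature.Analysis.FluidPDE.LeiZhang2011Proofs

/-!
# Shelf 1574, line `lamb_budget`: the enstrophy is slaved to the super-threshold Lamb budget —
# the fixed-time inequality (part 1 of stub 1 `EnstrophySlavedToIntenseLamb`)

Helper file (`--supports stmt-NavierStokesRegularity-1574 --as helper`; director KEY-NS #114 (2)). For ONE slice
`v = u(s)` (`0 ≤ s < T`) of a classical Leray–Hopf solution from a rapidly decaying datum (so all Sobolev
norms of the slice are finite, Tao's class) and every threshold `c₀ > 0`, with `ω = curl v`,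
`Z = ∫|ω|²`, `P = ∫|∇ω|²_F`, `S = ∫⟪ω,(∇v)ω⟫` and the super-threshold Lamb energy
`Λ = ∫_{ {|v| > c₀√(ν/(T−s))} } |ω × v|²`:

    `2S − 2νP ≤ (c₀²/(2(T−s))) Z + Λ/(2ν)`            (`slaving_slice`).

PROOF (the line card's computation, every step a tree theorem): the LAMB FORM of the stretching
`S = ∫⟪curl ω, v × ω⟫` (Farhat–Grujić 2018 (3)–(4) with `ψ ≡ 1`, tree
`FarhatGrujic2018.integral_stretching_eq_integral_inner_curl_cross`); Cauchy–Schwarz; the EXACT div–curl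
identity `∫|curl ω|² = ∫|∇ω|²_F` for the divergence-free `ω` (tree
`integral_frobeniusNormSq_fderiv_eq_integral_norm_curl_sq`, so no `√2` is lost and every `c₀ < 1` will be
admissible downstream); AM–GM `2√P L ≤ 2νP + L²/(2ν)`; and the split of `L² = ∫|ω × v|²` at the velocity
threshold: on the slow set `|ω × v|² ≤ |ω|²|v|² ≤ c₀²ν(T−s)⁻¹|ω|²`.

HONEST FRAMING: a fixed-time inequality about ONE hypothetical solution; nothing here bears on the
regularity problem; `EnstrophyQuarterLaw` (1574) and the Type-I wall (0056) stay OPEN. No summit statement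
is proved.
-/

noncomputable section

-- the summit-side namespace repeats a component by design (D-0017)
set_option linter.dupNamespace false

namespace Summit.NavierStokesRegularity.NavierStokesRegularity.Theorems.EnstrophyQuarterLaw.LambBudget

open Set MeasureTheory Function Metric Filter Topology
open scoped ENNReal NNReal RealInnerProductSpace
open Literature.Analysis.FluidPDE

/-! ### Elementary real-variable steps -/

/-- AM–GM in the form used by the slaving: `2 a L − 2 ν a² ≤ L²/(2ν)` for `ν > 0`
(`0 ≤ (2νa − L)²`; here `a = √P`). [folklore] -/
theorem two_mul_sub_le_sq_div {ν a L : ℝ} (hν : 0 < ν) :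
    2 * (a * L) - 2 * ν * a ^ 2 ≤ L ^ 2 / (2 * ν) := by
  rw [le_div_iff₀ (by positivity)]
  nlinarith [sq_nonneg (2 * ν * a - L)]

/-- `‖a × b‖ = ‖b × a‖`. [folklore] -/
theorem norm_cross_comm (a b : EuclideanSpace ℝ (Fin 3)) : ‖cross a b‖ = ‖cross b a‖ := by
  rw [norm_cross, norm_cross, InnerProductGeometry.angle_comm]; ring

/-! ### Tao's class for one slice -/

variable {ν T : ℝ} {u : ℝ → EuclideanSpace ℝ (Fin 3) → EuclideanSpace ℝ (Fin 3)}
  {p : ℝ → EuclideanSpace ℝ (Fin 3) → ℝ}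

/-- **All Sobolev seminorms of a slice are finite, with sup bounds on `u(s)` and `∇u(s)`** (Tao 2013,
Cor. 11.1 on the closed sub-slab `[0, (s+T)/2]`: `tao2011_hasBoundedSobolevNormsOn_holds`, `H² ⊂ L^∞`).
[cite: Tao2011, Cor. 11.1] -/
theorem slice_sobolev (hν : 0 < ν) (hsol : IsClassicalNSSolutionOn (Ico 0 T) ν 0 u p)
    (hLH : IsLerayHopfOn T ν 0 (u 0) u) (hdec : HasRapidSpatialDecay (u 0)) {s : ℝ} (hs : s ∈ Ico 0 T) :
    (∀ n : ℕ, ∫⁻ x, ‖iteratedFDeriv ℝ n (u s) x‖ₑ ^ 2 < ⊤) ∧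
      (∃ B₀ : ℝ, ∀ x, ‖u s x‖ ≤ B₀) ∧ (∃ B₁ : ℝ, ∀ x, ‖fderiv ℝ (u s) x‖ ≤ B₁) := by
  set S' : ℝ := (s + T) / 2 with hS'
  have hS'0 : 0 < S' := by rw [hS']; linarith [hs.1, hs.2]
  have hS'T : S' < T := by rw [hS']; linarith [hs.2]
  have hsS : s ∈ Icc 0 S' := ⟨hs.1, by rw [hS']; linarith [hs.2]⟩
  have hcl' : IsClassicalNSSolutionOn (Icc 0 S') ν 0 u p :=
    hsol.mono (Icc_subset_Ico_right hS'T) (uniqueDiffOn_Icc hS'0)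
  have hEn : ∃ C : ℝ≥0∞, C < ⊤ ∧ ∀ t ∈ Icc 0 S', ∫⁻ x, ‖u t x‖ₑ ^ 2 ≤ C :=
    ⟨ENNReal.ofReal (2 * VectorCalculus.kineticEnergy (u 0)), ENNReal.ofReal_lt_top, fun t ht =>
      hLH.lintegral_enorm_sq_le hν.le ⟨ht.1, ht.2.trans hS'T.le⟩⟩
  have hH : HasBoundedSobolevNormsOn (Icc 0 S') u :=
    (tao2011_hasBoundedSobolevNormsOn.closedSlab tao2011_hasBoundedSobolevNormsOn_holds
      linfty_bound_of_hasBoundedSobolevNormsOn_holds ν S' hν hS'0 u p hcl' hEn hdec).1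
  refine ⟨fun n => ?_, ?_, ?_⟩
  · obtain ⟨Cn, hCn⟩ := hH n
    exact (hCn s hsS).trans_lt ENNReal.coe_lt_top
  · obtain ⟨B₀, hB₀⟩ := linfty_bound_of_hasBoundedSobolevNormsOn_holds
      (fun t ht => (hcl'.contDiff_velocity ht).of_le (by norm_cast)) hH
    exact ⟨B₀, hB₀ s hsS⟩
  · obtain ⟨B₁, -, hB₁⟩ := exists_forall_norm_fderiv_le_of_hasBoundedSobolevNormsOn
      (fun t ht => (hcl'.contDiff_velocity ht).of_le (by norm_cast)) hH
    exact ⟨B₁, hB₁ s hsS⟩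

/-! ### The fixed-time slaving inequality -/

/-- **The enstrophy is slaved to the super-threshold Lamb budget, fixed time.** For a classical solution on
`[0, T)` (`ν > 0`), Leray–Hopf from a rapidly decaying datum, a time `s ∈ [0, T)` and a threshold `c₀ > 0`,
with `ω = curl u(s)`:
`2∫⟪ω,(∇u)ω⟫ − 2ν∫|∇ω|²_F ≤ (c₀²/(2(T−s))) ∫|ω|² + (2ν)⁻¹ ∫_{ {|u(s)| > c₀√(ν/(T−s))} } |ω × u|²`
(the last integral is finite). Lamb form of the stretching + Cauchy–Schwarz + `∫|curl ω|² = ∫|∇ω|²_F`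
+ AM–GM + threshold split. [cite: FarhatGrujic2018, §2 eq. (1) and identities (3)–(4) (with ψ ≡ 1)] -/
theorem slaving_slice (hν : 0 < ν) (hT : 0 < T) (hsol : IsClassicalNSSolutionOn (Ico 0 T) ν 0 u p)
    (hLH : IsLerayHopfOn T ν 0 (u 0) u) (hdec : HasRapidSpatialDecay (u 0))
    {c₀ : ℝ} (hc₀ : 0 < c₀) {s : ℝ} (hs : s ∈ Ico 0 T) :
    (∫⁻ x in {x : EuclideanSpace ℝ (Fin 3) | c₀ * Real.sqrt (ν / (T - s)) < ‖u s x‖},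
        ‖cross (curl (u s) x) (u s x)‖ₑ ^ 2) < ⊤ ∧
    2 * (∫ x, ⟪curl (u s) x, fderiv ℝ (u s) x (curl (u s) x)⟫)
        - 2 * ν * (∫ x, frobeniusNormSq (fderiv ℝ (curl (u s)) x)) ≤
      c₀ ^ 2 / (2 * (T - s)) * (∫ x, ‖curl (u s) x‖ ^ 2) +
        (2 * ν)⁻¹ * (∫⁻ x in {x : EuclideanSpace ℝ (Fin 3) | c₀ * Real.sqrt (ν / (T - s)) < ‖u s x‖},
          ‖cross (curl (u s) x) (u s x)‖ₑ ^ 2).toReal := by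
  have _ := hT
  -- ### the slice and its vorticity
  obtain ⟨hfin, ⟨B₀, hB₀⟩, ⟨B₁, hB₁⟩⟩ := slice_sobolev hν hsol hLH hdec hs
  have hvs := hsol.contDiff_velocity hs
  have hdiv : VectorCalculus.IsDivFree (u s) := hsol.divFree s hs
  set v : EuclideanSpace ℝ (Fin 3) → EuclideanSpace ℝ (Fin 3) := u s with hv
  have hv2 : ContDiff ℝ 2 v := hvs.of_le (by norm_cast)
  have hv3 : ContDiff ℝ 3 v := hvs.of_le (by norm_cast)
  have hv4 : ContDiff ℝ 4 v := hvs.of_le (by norm_cast)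
  have hvc : Continuous v := hvs.continuous
  set ω : EuclideanSpace ℝ (Fin 3) → EuclideanSpace ℝ (Fin 3) := curl v with hω
  have hω2 : ContDiff ℝ 2 ω := contDiff_curl (n := 2) (by exact hv3)
  have hω1 : ContDiff ℝ 1 ω := hω2.of_le (by norm_cast)
  have hωc : Continuous ω := hω2.continuous
  have hcωc : Continuous (curl ω) := continuous_curl hω1
  have hωdiv : VectorCalculus.IsDivFree ω := fun x => divergence_curl_eq_zero_holds v hv2 x
  have hB₀0 : 0 ≤ B₀ := (norm_nonneg _).trans (hB₀ 0)
  -- `H^∞` bookkeeping for `ω`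
  have hωfin : ∀ n : ℕ, ∫⁻ x, ‖iteratedFDeriv ℝ n ω x‖ₑ ^ 2 < ⊤ :=
    Wei2016.lintegral_sq_iteratedFDeriv_curl_lt_top hvs hfin
  have hω0 : ∫⁻ x, ‖ω x‖ₑ ^ 2 < ⊤ := by
    refine lt_of_le_of_lt (le_of_eq (lintegral_congr fun x => ?_)) (hωfin 0)
    rw [← ofReal_norm, ← ofReal_norm, norm_iteratedFDeriv_zero]
  have hcω0 : ∫⁻ x, ‖curl ω x‖ₑ ^ 2 < ⊤ :=
    lt_of_le_of_lt (lintegral_curl_sq_le ω) (ENNReal.mul_lt_top ENNReal.ofReal_lt_top (hωfin 1))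
  -- ### integrability
  have Iω : Integrable fun x => ‖ω x‖ ^ 2 := integrable_sq_norm_of_lintegral_lt_top hωc hω0
  have Icω : Integrable fun x => ‖curl ω x‖ ^ 2 := integrable_sq_norm_of_lintegral_lt_top hcωc hcω0
  have i1 : Integrable fun x => ‖fderiv ℝ v x‖ ^ 2 := by
    have h := integrable_sq_norm_of_lintegral_lt_top (hv4.continuous_iteratedFDeriv (by norm_num)) (hfin 1)
    exact h.congr (Eventually.of_forall fun x => by simp only [norm_iteratedFDeriv_one])
  have i2 : Integrable fun x => ‖fderiv ℝ (fderiv ℝ v) x‖ ^ 2 := by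
    have h := integrable_sq_norm_of_lintegral_lt_top (hv4.continuous_iteratedFDeriv (by norm_num)) (hfin 2)
    refine h.congr (Eventually.of_forall fun x => ?_)
    show ‖iteratedFDeriv ℝ 2 v x‖ ^ 2 = ‖fderiv ℝ (fderiv ℝ v) x‖ ^ 2
    rw [← norm_iteratedFDeriv_fderiv, norm_iteratedFDeriv_one]
  have hLc : Continuous fun x => cross (ω x) (v x) := crossCLM.continuous₂.comp₂ hωc hvc
  have hpt_cross : ∀ x, ‖cross (ω x) (v x)‖ ^ 2 ≤ ‖ω x‖ ^ 2 * ‖v x‖ ^ 2 := fun x => by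
    rw [← mul_pow]
    exact pow_le_pow_left₀ (norm_nonneg _) (norm_cross_le_norm_mul_norm _ _) 2
  have IL : Integrable fun x => ‖cross (ω x) (v x)‖ ^ 2 := by
    refine (Iω.mul_const (B₀ ^ 2)).mono' (hLc.norm.pow 2).aestronglyMeasurable
      (Eventually.of_forall fun x => ?_)
    rw [Real.norm_of_nonneg (sq_nonneg _)]
    refine (hpt_cross x).trans (mul_le_mul_of_nonneg_left ?_ (sq_nonneg _))
    exact pow_le_pow_left₀ (norm_nonneg _) (hB₀ x) 2
  -- ### (1) the Lamb form of the stretching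
  have hFG : (∫ x, ⟪ω x, fderiv ℝ v x (ω x)⟫) = ∫ x, ⟪curl ω x, cross (v x) (ω x)⟫ :=
    FarhatGrujic2018.integral_stretching_eq_integral_inner_curl_cross hv2 hdiv hB₀ hB₁ i1 i2
  -- ### (2) Cauchy–Schwarz
  set P' : ℝ := ∫ x, ‖curl ω x‖ ^ 2 with hP'
  set L2 : ℝ := ∫ x, ‖cross (ω x) (v x)‖ ^ 2 with hL2
  have hP'0 : 0 ≤ P' := integral_nonneg fun x => sq_nonneg _
  have hL20 : 0 ≤ L2 := integral_nonneg fun x => sq_nonneg _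
  have Iprod : Integrable fun x => ‖curl ω x‖ * ‖cross (ω x) (v x)‖ := by
    have hmaj : Integrable fun x => (‖curl ω x‖ ^ 2 + ‖cross (ω x) (v x)‖ ^ 2) / 2 :=
      (Icω.add IL).div_const 2
    refine hmaj.mono' (hcωc.norm.mul hLc.norm).aestronglyMeasurable
      (Eventually.of_forall fun x => ?_)
    rw [Real.norm_of_nonneg (by positivity)]
    nlinarith [sq_nonneg (‖curl ω x‖ - ‖cross (ω x) (v x)‖)]
  have hCS : |∫ x, ⟪curl ω x, cross (v x) (ω x)⟫| ≤ Real.sqrt P' * Real.sqrt L2 := by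
    have h1 : |∫ x, ⟪curl ω x, cross (v x) (ω x)⟫| ≤ ∫ x, ‖curl ω x‖ * ‖cross (ω x) (v x)‖ := by
      rw [← Real.norm_eq_abs]
      refine norm_integral_le_of_norm_le Iprod (Eventually.of_forall fun x => ?_)
      rw [Real.norm_eq_abs, norm_cross_comm (ω x) (v x)]
      exact abs_real_inner_le_norm _ _
    have hmem1 : MemLp (fun x => ‖curl ω x‖) (ENNReal.ofReal 2) volume := by
      rw [ENNReal.ofReal_ofNat]
      refine (memLp_two_iff_integrable_sq_norm hcωc.norm.aestronglyMeasurable).2 ?_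
      exact Icω.congr (Eventually.of_forall fun x => by simp only [norm_norm])
    have hmem2 : MemLp (fun x => ‖cross (ω x) (v x)‖) (ENNReal.ofReal 2) volume := by
      rw [ENNReal.ofReal_ofNat]
      refine (memLp_two_iff_integrable_sq_norm hLc.norm.aestronglyMeasurable).2 ?_
      exact IL.congr (Eventually.of_forall fun x => by simp only [norm_norm])
    have h2 := integral_mul_le_Lp_mul_Lq_of_nonneg Real.HolderConjugate.two_two
      (Eventually.of_forall fun x => norm_nonneg (curl ω x))
      (Eventually.of_forall fun x => norm_nonneg (cross (ω x) (v x))) hmem1 hmem2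
    have e1 : (∫ x, ‖curl ω x‖ ^ (2 : ℝ)) ^ (1 / (2 : ℝ)) = Real.sqrt P' := by
      rw [Real.sqrt_eq_rpow, hP']
      congr 1
      exact integral_congr_ae (Eventually.of_forall fun x => Real.rpow_two _)
    have e2 : (∫ x, ‖cross (ω x) (v x)‖ ^ (2 : ℝ)) ^ (1 / (2 : ℝ)) = Real.sqrt L2 := by
      rw [Real.sqrt_eq_rpow, hL2]
      congr 1
      exact integral_congr_ae (Eventually.of_forall fun x => Real.rpow_two _)
    rw [e1, e2] at h2
    exact h1.trans h2
  -- ### (3) the exact div–curl identity for `ω`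
  have hdc : (∫ x, frobeniusNormSq (fderiv ℝ ω x)) = P' :=
    integral_frobeniusNormSq_fderiv_eq_integral_norm_curl_sq hω2 hωdiv hω0 (hωfin 1) (hωfin 2)
  -- ### (4) the threshold split of the Lamb energy
  set lam : ℝ := c₀ * Real.sqrt (ν / (T - s)) with hlam
  have hlam0 : 0 ≤ lam := by positivity
  have hTs : 0 < T - s := sub_pos.2 hs.2
  have hlam2 : lam ^ 2 = c₀ ^ 2 * (ν / (T - s)) := by
    rw [hlam, mul_pow, Real.sq_sqrt (by positivity)]
  set F : Set (EuclideanSpace ℝ (Fin 3)) := {x | lam < ‖v x‖} with hF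
  have hFm : MeasurableSet F := (isOpen_lt continuous_const hvc.norm).measurableSet
  have hsplit : L2 = (∫ x in F, ‖cross (ω x) (v x)‖ ^ 2) + ∫ x in Fᶜ, ‖cross (ω x) (v x)‖ ^ 2 :=
    (integral_add_compl hFm IL).symm
  have hslow : ∫ x in Fᶜ, ‖cross (ω x) (v x)‖ ^ 2 ≤ lam ^ 2 * ∫ x, ‖ω x‖ ^ 2 := by
    calc ∫ x in Fᶜ, ‖cross (ω x) (v x)‖ ^ 2 ≤ ∫ x in Fᶜ, lam ^ 2 * ‖ω x‖ ^ 2 := by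
          refine setIntegral_mono_on IL.integrableOn (Iω.const_mul _).integrableOn hFm.compl
            fun x hx => ?_
          have hvx : ‖v x‖ ≤ lam := not_lt.1 hx
          calc ‖cross (ω x) (v x)‖ ^ 2 ≤ ‖ω x‖ ^ 2 * ‖v x‖ ^ 2 := hpt_cross x
            _ ≤ ‖ω x‖ ^ 2 * lam ^ 2 :=
                mul_le_mul_of_nonneg_left (pow_le_pow_left₀ (norm_nonneg _) hvx 2) (sq_nonneg _)
            _ = lam ^ 2 * ‖ω x‖ ^ 2 := by ring
      _ ≤ ∫ x, lam ^ 2 * ‖ω x‖ ^ 2 :=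
          setIntegral_le_integral (Iω.const_mul _) (Eventually.of_forall fun x => by positivity)
      _ = lam ^ 2 * ∫ x, ‖ω x‖ ^ 2 := integral_const_mul _ _
  -- the fast part is the (finite) super-threshold Lamb energy
  have hfast_eq : ∫⁻ x in F, ‖cross (ω x) (v x)‖ₑ ^ 2 =
      ENNReal.ofReal (∫ x in F, ‖cross (ω x) (v x)‖ ^ 2) := by
    rw [ofReal_integral_eq_lintegral_ofReal IL.integrableOn (Eventually.of_forall fun x => sq_nonneg _)]
    refine lintegral_congr fun x => ?_
    rw [← ofReal_norm, ENNReal.ofReal_pow (norm_nonneg _)]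
  have hfast_fin : ∫⁻ x in F, ‖cross (ω x) (v x)‖ₑ ^ 2 < ⊤ := by
    rw [hfast_eq]; exact ENNReal.ofReal_lt_top
  have hfast_toReal : (∫⁻ x in F, ‖cross (ω x) (v x)‖ₑ ^ 2).toReal = ∫ x in F, ‖cross (ω x) (v x)‖ ^ 2 := by
    rw [hfast_eq, ENNReal.toReal_ofReal (setIntegral_nonneg hFm fun x _ => sq_nonneg _)]
  refine ⟨hfast_fin, ?_⟩
  -- ### (5) assembly
  set Z : ℝ := ∫ x, ‖ω x‖ ^ 2 with hZ
  have hZ0 : 0 ≤ Z := integral_nonneg fun x => sq_nonneg _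
  have hS_le : (∫ x, ⟪ω x, fderiv ℝ v x (ω x)⟫) ≤ Real.sqrt P' * Real.sqrt L2 := by
    rw [hFG]; exact (le_abs_self _).trans hCS
  have hAMGM := two_mul_sub_le_sq_div (a := Real.sqrt P') (L := Real.sqrt L2) hν
  rw [Real.sq_sqrt hP'0, Real.sq_sqrt hL20] at hAMGM
  have hL2le : L2 ≤ lam ^ 2 * Z + (∫⁻ x in F, ‖cross (ω x) (v x)‖ₑ ^ 2).toReal := by
    rw [hsplit, hfast_toReal]; linarith
  have hcoef : lam ^ 2 * Z / (2 * ν) = c₀ ^ 2 / (2 * (T - s)) * Z := by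
    rw [hlam2]; field_simp
  calc 2 * (∫ x, ⟪ω x, fderiv ℝ v x (ω x)⟫) - 2 * ν * (∫ x, frobeniusNormSq (fderiv ℝ ω x))
      ≤ 2 * (Real.sqrt P' * Real.sqrt L2) - 2 * ν * P' := by rw [hdc]; linarith
    _ ≤ L2 / (2 * ν) := hAMGM
    _ ≤ (lam ^ 2 * Z + (∫⁻ x in F, ‖cross (ω x) (v x)‖ₑ ^ 2).toReal) / (2 * ν) :=
        div_le_div_of_nonneg_right hL2le (by positivity)
    _ = c₀ ^ 2 / (2 * (T - s)) * Z + (2 * ν)⁻¹ * (∫⁻ x in F, ‖cross (ω x) (v x)‖ₑ ^ 2).toReal := by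
        rw [add_div, hcoef]
        ring

end Summit.NavierStokesRegularity.NavierStokesRegularity.Theorems.EnstrophyQuarterLaw.LambBudget

end
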